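import Mathlib
import Summits.NavierStokesRegularity.NavierStokesRegularity.Theorems.FilamentSkeletonRssDefectColumnGateSeparable2D
import Summits.NavierStokesRegularity.NavierStokesRegularity.Theorems.FilamentSkeletonRssDefectColumnGateLogProfile
import Summits.NavierStokesRegularity.NavierStokesRegularity.Theorems.FilamentSkeletonRssDefectColumnGateWaistQuasimodes

/-!
# Route `FilamentSkeletonRss` · crux `TransverseReduction1AG` (stmt-NavierStokesRegularity-27853) · line `defect_column_gate_1AG` —
# THE FAR-FIELD QUASIMODE: witness strain `B₀`, the stream function `Ψ_L(y) = F_L(y₀)E(y₁)`, and the POINTWISE ESTIMATE `⟨ξ⟩⁴|colForceVort| ≤ K/L`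

Helper file (`--supports stmt-NavierStokesRegularity-27853 --as helper`; LEAD of 27853, lane ns-filament-21221-p1 g10).  Heart of the owed construction
`FarFieldQuasimodes1A` (memo S2A-FALSE-FARFIELD-27853-g10.md §3/§6/§9): for the witness frame gradient `B₀ = diag(1/5, −3/10, 8/5)` (axis `e₃`, `gam = 1/10`,
asymmetry `s = 1/4 = 5gam/2`, `λ₂ = 3/10`), the horizontal perturbation `W_L = ∇Ψ_L × e₃`, `Ψ_L(y) = F_L(y₀)·e^{−λ₂y₁²/2}`, `F_L = χ₀(log y₀/L)y₀⁻⁴`, satisfies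
`(1 + y₀² + y₁²)²·|colForceVort B₀ 0 gam Rc e₃ W_L (y)| ≤ K(Rc)/L` for all `L ≥ 1` and all `y` — the EXACT cancellation of the leading far-field bracket
`E⁗ + λ₂yE‴ + 3λ₂E″ = 0` (Hermite, `μ = 3λ₂`) leaves only the `1/L` commutator with the dilation, `O(y₀⁻²)` curvature terms and `O(Rc/y₀)` column terms.
HONEST FRAMING: real analysis on an explicit MODEL operator; MODEL rung, negative side; nothing here bears on Navier–Stokes regularity.
-/

set_option linter.dupNamespace false

noncomputable section

namespace Summit.NavierStokesRegularity.NavierStokesRegularity.Theorems.DefectColumnGate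

open scoped BigOperators Topology InnerProductSpace Laplacian ContDiff
open Set Function Filter
open Literature.Analysis.FluidPDE
open Summit.NavierStokesRegularity.NavierStokesRegularity.Theorems.KelvinGate

/-! ## 1. The witness frame gradient `B₀ = diag(1/5, −3/10, 8/5)` -/

/-- `B₀ = (1/5)e₀⊗e₀ − (3/10)e₁⊗e₁ + (8/5)e₂⊗e₂`. -/
def waistB0 : EuclideanSpace ℝ (Fin 3) →L[ℝ] EuclideanSpace ℝ (Fin 3) :=
  (1/5 : ℝ) • (innerSL ℝ (EuclideanSpace.single (0 : Fin 3) (1:ℝ))).smulRight (EuclideanSpace.single 0 1) +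
    (-(3/10) : ℝ) • (innerSL ℝ (EuclideanSpace.single (1 : Fin 3) (1:ℝ))).smulRight (EuclideanSpace.single 1 1) +
    (8/5 : ℝ) • (innerSL ℝ (EuclideanSpace.single (2 : Fin 3) (1:ℝ))).smulRight (EuclideanSpace.single 2 1)

/-- `B₀ y = (y₀/5)e₀ − (3y₁/10)e₁ + (8y₂/5)e₂`. -/
theorem waistB0_apply (y : EuclideanSpace ℝ (Fin 3)) :
    waistB0 y = (1/5 * y 0) • EuclideanSpace.single 0 1 + (-(3/10) * y 1) • EuclideanSpace.single 1 1 + (8/5 * y 2) • EuclideanSpace.single 2 1 := by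
  simp only [waistB0, _root_.add_apply, _root_.smul_apply, ContinuousLinearMap.smulRight_apply, innerSL_apply_apply,
    EuclideanSpace.inner_single_left, map_one, one_mul, smul_smul]

/-- `B₀ e₀ = (1/5) e₀`. -/
theorem waistB0_single_zero : waistB0 (EuclideanSpace.single 0 1) = (1/5 : ℝ) • EuclideanSpace.single 0 1 := by
  rw [waistB0_apply]; simp

/-- `B₀ e₁ = −(3/10) e₁`. -/
theorem waistB0_single_one : waistB0 (EuclideanSpace.single 1 1) = (-(3/10) : ℝ) • EuclideanSpace.single 1 1 := by
  rw [waistB0_apply]; simp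

/-- `B₀ e₂ = (8/5) e₂`. -/
theorem waistB0_single_two : waistB0 (EuclideanSpace.single 2 1) = (8/5 : ℝ) • EuclideanSpace.single 2 1 := by
  rw [waistB0_apply]; simp

/-- Sectional trace: `⟨B₀e₀,e₀⟩ + ⟨B₀e₁,e₁⟩ = 3/2 − 8/5`. -/
theorem waistB0_trace :
    ⟪waistB0 (EuclideanSpace.single 0 1), EuclideanSpace.single (0 : Fin 3) (1:ℝ)⟫_ℝ +
      ⟪waistB0 (EuclideanSpace.single 1 1), EuclideanSpace.single (1 : Fin 3) (1:ℝ)⟫_ℝ = 3/2 - 8/5 := by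
  rw [waistB0_single_zero, waistB0_single_one, real_inner_smul_left, real_inner_smul_left]
  simp; norm_num

/-- `‖B₀‖ ≤ 10` (crudely: `‖B₀ y‖ ≤ (1/5 + 3/10 + 8/5)‖y‖`). -/
theorem norm_waistB0_le : ‖waistB0‖ ≤ 10 := by
  refine ContinuousLinearMap.opNorm_le_bound _ (by norm_num) fun y => ?_
  have hc : ∀ (i : Fin 3), |y i| ≤ ‖y‖ := fun i => by
    have h := abs_real_inner_le_norm (EuclideanSpace.single i (1:ℝ)) y
    rw [EuclideanSpace.inner_single_left] at h
    simpa [EuclideanSpace.norm_eq] using h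
  have hn : ∀ (i : Fin 3) (c : ℝ), ‖c • EuclideanSpace.single i (1:ℝ)‖ = |c| := fun i c => by
    rw [norm_smul, Real.norm_eq_abs]; rw [EuclideanSpace.norm_eq]; simp
  rw [waistB0_apply]
  calc ‖(1/5 * y 0) • EuclideanSpace.single (0 : Fin 3) (1:ℝ) + (-(3/10) * y 1) • EuclideanSpace.single 1 1 + (8/5 * y 2) • EuclideanSpace.single 2 1‖
      ≤ ‖(1/5 * y 0) • EuclideanSpace.single (0 : Fin 3) (1:ℝ)‖ + ‖(-(3/10) * y 1) • EuclideanSpace.single (1 : Fin 3) (1:ℝ)‖ +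
          ‖(8/5 * y 2) • EuclideanSpace.single (2 : Fin 3) (1:ℝ)‖ := norm_add₃_le
    _ = 1/5 * |y 0| + 3/10 * |y 1| + 8/5 * |y 2| := by
          rw [hn, hn, hn, abs_mul, abs_mul, abs_mul]; norm_num
    _ ≤ 1/5 * ‖y‖ + 3/10 * ‖y‖ + 8/5 * ‖y‖ := by gcongr <;> exact hc _
    _ ≤ 10 * ‖y‖ := by nlinarith [norm_nonneg y]

/-- The frozen base `colBase B₀ 0 gam Rc e₃` is divergence free (tree `isDivFree_colBase`). -/
theorem isDivFree_colBase_waistB0 (gam Rc : ℝ) : VectorCalculus.IsDivFree (colBase waistB0 0 gam Rc (EuclideanSpace.single 2 1)) :=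
  isDivFree_colBase orthonormal_e3_e1_e2 waistB0_single_two waistB0_trace 0 gam Rc

/-! ## 2. Coordinates of the section about `e₃` -/

/-- `|y|² − ⟨y,e₃⟩² = y₀² + y₁²`. -/
theorem norm_sq_sub_inner_e3_sq (y : EuclideanSpace ℝ (Fin 3)) :
    ‖y‖ ^ 2 - ⟪y, EuclideanSpace.single 2 1⟫_ℝ ^ 2 = y 0 ^ 2 + y 1 ^ 2 := by
  rw [EuclideanSpace.norm_sq_eq, Fin.sum_univ_three, EuclideanSpace.inner_single_right]
  simp [Real.norm_eq_abs, sq_abs]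

/-- `secWt e₃ y = 1 + y₀² + y₁²`. -/
theorem secWt_e3 (y : EuclideanSpace ℝ (Fin 3)) : secWt (EuclideanSpace.single 2 1) y = 1 + y 0 ^ 2 + y 1 ^ 2 := by
  rw [secWt, add_sub_assoc, norm_sq_sub_inner_e3_sq, add_assoc]

/-- Splitting the weight: `(1 + a + b)² ≤ (1+a)²(1+b)²` for `a, b ≥ 0`. -/
theorem weight_split {a b : ℝ} (ha : 0 ≤ a) (hb : 0 ≤ b) : (1 + a + b) ^ 2 ≤ (1 + a) ^ 2 * (1 + b) ^ 2 := by
  rw [← mul_pow]; apply pow_le_pow_left₀ (by linarith); nlinarith [mul_nonneg ha hb]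

/-- For `|x| ≥ 1`: `(1 + x²)² ≤ 4x⁴`. -/
theorem weight_le_four_pow {x : ℝ} (hx : 1 ≤ |x|) : (1 + x ^ 2) ^ 2 ≤ 4 * |x| ^ 4 := by
  have h1 : 1 ≤ x ^ 2 := by rw [← sq_abs]; exact one_le_pow₀ hx
  have e : |x| ^ 4 = (x ^ 2) ^ 2 := by rw [show (4:ℕ) = 2 * 2 from rfl, pow_mul, sq_abs]
  rw [e]; nlinarith

/-! ## 3. The Gaussian polynomials -/

/-- `λ₂ = 3/10`. -/
def lamW : ℝ := 3/10

/-- `λ₂ > 0`. -/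
theorem lamW_pos : 0 < lamW := by rw [lamW]; norm_num

/-- `E′ = p₁E`, `E″ = p₂E`, `E‴ = p₃E`, `E⁗ = p₄E`. -/
theorem deriv_gaussE_eq (lam : ℝ) : deriv (gaussE lam) = fun y => (-(lam * y)) * gaussE lam y :=
  funext fun y => (hasDerivAt_gaussE lam y).deriv

/-- `E″ = (lam²y² − lam)·E`. -/
theorem deriv2_gaussE_eq (lam : ℝ) : deriv (deriv (gaussE lam)) = fun y => (lam ^ 2 * y ^ 2 - lam) * gaussE lam y := by
  rw [deriv_gaussE_eq]
  funext y
  have hp : HasDerivAt (fun y : ℝ => -(lam * y)) (-(lam * 1)) y := ((hasDerivAt_id y).const_mul lam).neg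
  have h := hasDerivAt_mul_gaussE (lam := lam) hp
  rw [h.deriv]; ring

/-- `E‴ = (−lam³y³ + 3lam²y)·E`. -/
theorem deriv3_gaussE_eq (lam : ℝ) : deriv^[3] (gaussE lam) = fun y => (-(lam ^ 3 * y ^ 3) + 3 * lam ^ 2 * y) * gaussE lam y := by
  rw [show deriv^[3] (gaussE lam) = deriv (deriv (deriv (gaussE lam))) by simp [Function.iterate_succ_apply'], deriv2_gaussE_eq]
  funext y
  have h2 : HasDerivAt (fun y : ℝ => y ^ 2) (2 * y) y := by simpa using hasDerivAt_pow 2 y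
  have hp : HasDerivAt (fun y : ℝ => lam ^ 2 * y ^ 2 - lam) (lam ^ 2 * (2 * y)) y := (h2.const_mul (lam ^ 2)).sub_const lam
  have h := hasDerivAt_mul_gaussE (lam := lam) hp
  rw [h.deriv]; ring

/-- `E⁗ = (lam⁴y⁴ − 6lam³y² + 3lam²)·E`. -/
theorem deriv4_gaussE_eq (lam : ℝ) :
    deriv^[4] (gaussE lam) = fun y => (lam ^ 4 * y ^ 4 - 6 * lam ^ 3 * y ^ 2 + 3 * lam ^ 2) * gaussE lam y := by
  rw [show deriv^[4] (gaussE lam) = deriv (deriv^[3] (gaussE lam)) by simp [Function.iterate_succ_apply'], deriv3_gaussE_eq]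
  funext y
  have h3 : HasDerivAt (fun y : ℝ => y ^ 3) (3 * y ^ 2) y := by simpa using hasDerivAt_pow 3 y
  have ha : HasDerivAt (fun y : ℝ => -(lam ^ 3 * y ^ 3)) (-(lam ^ 3 * (3 * y ^ 2))) y := (h3.const_mul (lam ^ 3)).neg
  have hb : HasDerivAt (fun y : ℝ => 3 * lam ^ 2 * y) (3 * lam ^ 2 * 1) y := (hasDerivAt_id y).const_mul (3 * lam ^ 2)
  have hp : HasDerivAt (fun y : ℝ => -(lam ^ 3 * y ^ 3) + 3 * lam ^ 2 * y) (-(lam ^ 3 * (3 * y ^ 2)) + 3 * lam ^ 2 * 1) y := ha.add hb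
  have h := hasDerivAt_mul_gaussE (lam := lam) hp
  rw [h.deriv]; ring

/-! ## 4. The stream function and the closed form of the operator -/

/-- The quasimode stream function `Ψ_L(y) = F_L(y₀)·E(y₁)`. -/
def farPsi (L : ℝ) (y : EuclideanSpace ℝ (Fin 3)) : ℝ := farProfile L 0 (y 0) * gaussE lamW (y 1)

/-- The quasimode velocity (unnormalised): `W_L = ∇Ψ_L × e₃`. -/
def farW (L : ℝ) (y : EuclideanSpace ℝ (Fin 3)) : EuclideanSpace ℝ (Fin 3) := cross (gradient (farPsi L) y) (EuclideanSpace.single 2 1)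

/-- **The S2a operator on the quasimode, written out** (`colForceVort_sep` with `F = F_L`, `G = E`, the derivative tables of §3 and of
`…LogProfile`). -/
theorem colForceVort_farW {L : ℝ} (hL : 0 < L) (Rc : ℝ) (y : EuclideanSpace ℝ (Fin 3)) :
    colForceVort waistB0 0 (8/5 - 3/2 : ℝ) Rc (EuclideanSpace.single 2 1) (farW L) y =
      ( gaussE lamW (y 1) *
        ( (8/5 - 3/2) * (farProfile L 2 (y 0) + farProfile L 0 (y 0) * (lamW ^ 2 * y 1 ^ 2 - lamW))
          - 1/5 * y 0 * (farProfile L 3 (y 0) + farProfile L 1 (y 0) * (lamW ^ 2 * y 1 ^ 2 - lamW))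
          - (-(3/10)) * y 1 * (farProfile L 2 (y 0) * (-(lamW * y 1)) + farProfile L 0 (y 0) * (-(lamW ^ 3 * y 1 ^ 3) + 3 * lamW ^ 2 * y 1))
          + (farProfile L 4 (y 0) + 2 * (farProfile L 2 (y 0) * (lamW ^ 2 * y 1 ^ 2 - lamW))
              + farProfile L 0 (y 0) * (lamW ^ 4 * y 1 ^ 4 - 6 * lamW ^ 3 * y 1 ^ 2 + 3 * lamW ^ 2))
          + ((8/5 - 3/2) * Rc / (8 * Real.pi) * burgersPhi ((8/5 - 3/2) * (y 0 ^ 2 + y 1 ^ 2) / 4)) *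
              (y 1 * (farProfile L 3 (y 0) + farProfile L 1 (y 0) * (lamW ^ 2 * y 1 ^ 2 - lamW))
                - y 0 * (farProfile L 2 (y 0) * (-(lamW * y 1)) + farProfile L 0 (y 0) * (-(lamW ^ 3 * y 1 ^ 3) + 3 * lamW ^ 2 * y 1)))
          - (8/5 - 3/2) / 2 * ((8/5 - 3/2) * Rc / (4 * Real.pi) * Real.exp (-((8/5 - 3/2) * (y 0 ^ 2 + y 1 ^ 2) / 4))) *
              (y 0 * (farProfile L 0 (y 0) * (-(lamW * y 1))) - y 1 * (farProfile L 1 (y 0))) ) )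
        • EuclideanSpace.single 2 1 := by
  have hF : ContDiff ℝ 4 (farProfile L 0) := contDiff_farProfile hL 0
  have hG : ContDiff ℝ 4 (gaussE lamW) := contDiff_gaussE lamW
  have h := colForceVort_sep hF hG waistB0_single_zero waistB0_single_one waistB0_single_two (isDivFree_colBase_waistB0 _ Rc) y
    (gam := (8/5 - 3/2 : ℝ)) (Rc := Rc)
  unfold farW farPsi
  rw [h, norm_sq_sub_inner_e3_sq]
  have d1F : deriv (farProfile L 0) = farProfile L 1 := deriv_farProfile hL 0
  have d2F : deriv (deriv (farProfile L 0)) = farProfile L 2 := by rw [d1F, deriv_farProfile hL 1]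
  have d3F : deriv^[3] (farProfile L 0) = farProfile L 3 := iterate_deriv_farProfile hL 3
  have d4F : deriv^[4] (farProfile L 0) = farProfile L 4 := iterate_deriv_farProfile hL 4
  rw [d3F, d4F, d2F, d1F, deriv3_gaussE_eq, deriv4_gaussE_eq, deriv2_gaussE_eq, deriv_gaussE_eq]
  beta_reduce
  congr 1
  ring

end Summit.NavierStokesRegularity.NavierStokesRegularity.Theorems.DefectColumnGate

end
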